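/-
Copyright (c) 2026 The HCML crux team. All rights reserved.
Released under Apache 2.0 license as described in the file LICENSE.
Authors: K2E5-p17 (g4) (explicit-unit `hodgecm-mathlib-K2E5-p17-g4`)
-/
import Summits.HodgeConjecture.HodgeConjecture.Theorems.K2E3GLnUnipotentAdHeight      -- ★ V0 p858112 (K2E3-p14 (g5)): `𝔅` vs unipotent ∕ diagonal; brings ★ B4-0 `K2E3GLnAdHeightBalls`
import Literature.NumberTheory.Automorphic.GLnCongruenceSubgroups                       -- ★ `congruenceGL`, `ValBound`, `mem_unipotentRadicalGL_iff_apply`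
import Literature.NumberTheory.Automorphic.GLnTwoBlockLeviStructure                     -- ★ `mem_standardLeviGL_iff`, `conj_mem_unipotentRadicalGL_of_mem_standardLeviGL`
import Literature.NumberTheory.Automorphic.ValuedFieldValuativeRelBridge                -- ★ `v_le_iff_valuation_le`, `v_le_one_iff_valuation_le_one`; `CartanUnique.v_uniformizer_pow`
import HarnessLib

/-!
# K2_E3 road (h413), U12 «Characters» — Theorem 20 for `GL_n(F)`, FILE (B-val) part 1: the VALUATION INPUTS of the polychotomy ★ (A)
# (`K_γ ⊆ 𝔅_0`, the deep level `y K_{m+s} y⁻¹ ⊆ K_m` for `y ∈ 𝔅_s`, and for a GENERAL block labelling `c` the hypotheses `hV`, `hT` (Levi defect), `hnormU`,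
# `hcontr`, `h54` of a diagonal piece)

Cell `pub/hodgecm-mathlib` (D-0151), Track B, seat K2E5-p17 (g4); line lead K2E3-p23 (g5) (RULINGS #12 (M12-3)), co-owner K2E3-p21 (g5) ((B-Iw) ★∕p858151
`K2E3GLnCongruenceIwahoriTriple`: the Iwahori orders `hIw` and their transport), dealer K2E3-plan (g3).  `--supports stmt-HodgeConjecture-24833 --as helper`;
THEOREMS ONLY (no definition ∕ instance ∕ notation ∕ named fact ∕ `sorry`); never imports `Cruxes/…/Lines`.  COUNT-NEUTRAL.
Consumers: part 2 `K2E3GL3CuspFormCancellationCover` (the GL₃ covers) and FILE (C) `K2E3GL3CuspFormCancellation` (with ★ (A) `K2E3CuspFormCancellationPolychotomy`, ★ (A′)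
`…PolychotomyTransport`).

SETTING.  `F` a field with `Valued F ℤᵐ⁰` AND a compatible `ValuativeRel F` (the HEIGHT BALLS `𝔅_k(g) :≡ ∀ i j k l, |ϖ^k g_{ij} (g⁻¹)_{kl}| ≤ 1` of ★ B4-0 are written
in `Valued.v`, the LEVELS `K_γ = congruenceGL n γ` in `valuation F`; ★ `ValuedFieldValuativeRelBridge` is the dictionary); `ϖ` a uniformiser
(`Valued.v ϖ = exp (-1)`); `n` arbitrary.  A DIRECTION is a block labelling `c : Fin n → α` (`α` a finite linear order): `U_c = unipotentRadicalGL F c`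
(roots `c i < c j`), the opposite radical `V_c = unipotentRadicalGL F (toDual ∘ c)`, the Levi `T_c = standardLeviGL F c`; its PIECE with contraction depth `h` and
Levi defect `E` is the set of diagonal `a = diag(d)` with `|d_i⁻¹ d_j| ≤ |ϖ^h|` for `c i < c j` («`a⁻¹` contracts `U_c` by `q^{-h}`») and `|ϖ^E d_i d_j⁻¹| ≤ 1` for
`c i = c j` («`a` is `E`-bounded on the Levi»).  [HarishChandra1970, VII §8]: `P = P_F`, `a ∈ A_F^+(t)`; [Casselman1995, Prop. 1.4.3].
* §1 valuation arithmetic: `valuation_mul_le_pow_of_le'` (the level estimate, ★ U3Torus's with `h` for `h+1`), `exists_v_eq_exp`, the `exp`-dictionary `v_inv_mul_le_iff`,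
  `v_pow_mul_div_le_one_iff`.
* §2 levels vs balls: **`adBall_zero_of_mem_congruenceGL`** (`K_γ ⊆ 𝔅_0`), `v_conj_apply_le` and **`conj_mem_congruenceGL_of_adBall`** (`y ∈ 𝔅_s`, `u ∈ K_{|ϖ|^{m+s}}`
  ⇒ `y u y⁻¹ ∈ K_{|ϖ|^m}` — the deep level; note `m + s`, not `m + 2s`: `𝔅` bounds the products `y_{ik}(y⁻¹)_{lj}` jointly).
* §3 general labels, `a = diag(d)`: `coe_conj_apply_of_coe_eq_diagonal` ∕ `coe_inv_conj_apply_of_coe_eq_diagonal` (entries of `a g a⁻¹`, `a⁻¹ g a`),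
  `mem_standardLeviGL_of_coe_eq_diagonal`, **`conj_mem_unipotentRadicalGL_of_coe_eq_diagonal`** (`hnormU`), **`conj_mem_congruenceGL_of_pattern`** (generic: `a g a⁻¹ ∈ K_γ`
  as soon as `|d_i d_j⁻¹| ≤ 1` wherever `g` or `g⁻¹` is off the identity) ⇒ **`conj_mem_congruenceGL_of_mem_oppositeRadical`** (`hV`), **`adBall_conj_of_mem_standardLeviGL`**
  (`hT`: `a (K_γ ∩ T_c) a⁻¹ ⊆ 𝔅_{E+E}`), `v_pow_mul_apply_le_one_of_adBall_of_mem` (entries of `U_c ∩ 𝔅_k`), **`inv_conj_mem_congruenceGL_of_adBall`** (`hcontr`: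
  `a⁻¹ (U_c ∩ 𝔅_k) a ⊆ K_{|ϖ|^j}` for `j + k ≤ h`), **`adBall_two_mul_of_mem_unipotentRadicalGL`** (`h54`, from ★ V0).

HONEST LABEL: HC_CM is proved only modulo the 7 printed citations (2 remaining named inputs: hLiu418 = stmt-HodgeConjecture-24832, h413 = stmt-HodgeConjecture-24833)
until rung 0 closes; count-neutral helper (valuation bookkeeping of print's §8; nothing printed is asserted).

## References
* [HarishChandra1970] Harish-Chandra (notes by G. van Dijk), *Harmonic Analysis on Reductive p-adic Groups*, LNM 162 (1970), Part VII §2 p. 69 (heights), §8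
  Lemmas 54–56 pp. 81–83 (`(a⁻¹ n a)_{ij} = a_i⁻¹ a_j n_{ij}`, `(N̄ ∩ K)^a (M ∩ K) ⊂ ω₀`).
* [Casselman1995] W. Casselman, *Introduction to the theory of admissible representations of p-adic reductive groups* (1995), Prop. 1.4.3.
* [BernsteinZelevinsky1977] I. N. Bernstein, A. V. Zelevinsky, *Induced representations of reductive p-adic groups I*, Ann. Sci. ÉNS 10 (1977), §2.1 (`P_β`, `M_β`, `U_β`).
-/

set_option autoImplicit false
set_option linter.dupNamespace false   -- `Summit.HodgeConjecture.HodgeConjecture.…` (D-0017 nested layout; lakefile exemption for Summits)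

noncomputable section

open scoped MatrixGroups WithZero
open Matrix ValuativeRel
open Literature.NumberTheory.Automorphic
open Summit.HodgeConjecture.HodgeConjecture.Cruxes.H413.K2E3GLnAdHeightBalls
open Summit.HodgeConjecture.HodgeConjecture.Cruxes.H413.K2E3GLnUnipotentAdHeight

namespace Summit.HodgeConjecture.HodgeConjecture.Cruxes.H413.K2E3GLnCuspFormCancellationInputs

/-! ## §1 Valuation arithmetic -/

section Val

variable {K : Type*} [Field K] [Valued K ℤᵐ⁰] {ϖ : K} (hϖ : Valued.v ϖ = WithZero.exp (-1 : ℤ))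

include hϖ in
/-- `Valued.v (ϖ ^ h) = exp (-h)` and it is non-zero and `≤ 1`. [cite: Serre1979, Ch. I §1] -/
theorem v_pow_ne_zero (h : ℕ) : Valued.v (ϖ ^ h) ≠ 0 := by
  rw [CartanUnique.v_uniformizer_pow hϖ h]; exact WithZero.exp_ne_zero

/-- Non-zero elements have valuation `exp x` for an integer `x`. [cite: Serre1979, Ch. I §1] -/
theorem exists_v_eq_exp {ι : Type*} (d : ι → K) (hd : ∀ i, d i ≠ 0) : ∃ x : ι → ℤ, ∀ i, Valued.v (d i) = WithZero.exp (x i) := by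
  refine ⟨fun i => WithZero.log (Valued.v (d i)), fun i => ?_⟩
  rw [WithZero.exp_log ((Valuation.ne_zero_iff _).2 (hd i))]

include hϖ in
/-- THE `exp`-DICTIONARY, contraction form: `|d_i⁻¹ d_j| ≤ |ϖ^h| ↔ x_j + h ≤ x_i` (`|d_i| = exp x_i`). [cite: HarishChandra1970, Part VII §8 p. 82] -/
theorem v_inv_mul_le_iff {ι : Type*} {d : ι → K} {x : ι → ℤ} (hx : ∀ i, Valued.v (d i) = WithZero.exp (x i)) (i j : ι) (h : ℕ) :
    Valued.v ((d i)⁻¹ * d j) ≤ Valued.v (ϖ ^ h) ↔ x j + h ≤ x i := by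
  rw [map_mul, map_inv₀, hx i, hx j, CartanUnique.v_uniformizer_pow hϖ h, ← WithZero.exp_neg, ← WithZero.exp_add, WithZero.exp_le_exp]
  omega

include hϖ in
/-- THE `exp`-DICTIONARY, defect form: `|ϖ^E d_i d_j⁻¹| ≤ 1 ↔ x_i ≤ x_j + E`. [cite: HarishChandra1970, Part VII §2 p. 69] -/
theorem v_pow_mul_div_le_one_iff {ι : Type*} {d : ι → K} {x : ι → ℤ} (hx : ∀ i, Valued.v (d i) = WithZero.exp (x i)) (i j : ι) (E : ℕ) :
    Valued.v (ϖ ^ E * (d i * (d j)⁻¹)) ≤ 1 ↔ x i ≤ x j + E := by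
  rw [map_mul, map_mul, map_inv₀, hx i, hx j, CartanUnique.v_uniformizer_pow hϖ E, ← WithZero.exp_neg, ← WithZero.exp_add, ← WithZero.exp_add,
    ← WithZero.exp_zero, WithZero.exp_le_exp]
  omega

variable [ValuativeRel K] [(Valued.v : Valuation K ℤᵐ⁰).Compatible]

include hϖ in
/-- **THE LEVEL ESTIMATE** (Lemma 55 entrywise): `|ϖ^k x| ≤ 1`, `|r| ≤ |ϖ^h|`, `j + k ≤ h` ⇒ `valuation(x · r) ≤ valuation(ϖ)^j` — the entry bound of membership in
`K_{|ϖ|^j}`. (★ U3Torus `valuation_mul_le_pow_of_le` with `h` for `h + 1`.) [cite: HarishChandra1970, Part VII §8 Lemma 55 p. 83] -/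
theorem valuation_mul_le_pow_of_le' {x r : K} {k h j : ℕ} (hx : Valued.v (ϖ ^ k * x) ≤ 1) (hr : Valued.v r ≤ Valued.v (ϖ ^ h)) (hjk : j + k ≤ h) :
    valuation K (x * r) ≤ valuation K ϖ ^ j := by
  have hϖ1 : Valued.v ϖ ≤ 1 := by rw [hϖ, ← WithZero.exp_zero, WithZero.exp_le_exp]; norm_num
  have hk0 : Valued.v (ϖ ^ k) ≠ 0 := v_pow_ne_zero hϖ k
  have h1 : Valued.v (ϖ ^ k) * Valued.v (x * r) ≤ Valued.v (ϖ ^ k) * Valued.v (ϖ ^ (h - k)) := by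
    calc Valued.v (ϖ ^ k) * Valued.v (x * r) = Valued.v (ϖ ^ k * x) * Valued.v r := by rw [map_mul, map_mul, mul_assoc]
      _ ≤ 1 * Valued.v (ϖ ^ h) := mul_le_mul' hx hr
      _ = Valued.v (ϖ ^ k) * Valued.v (ϖ ^ (h - k)) := by rw [one_mul, ← map_mul, ← pow_add]; congr 2; omega
  have h2 : Valued.v (x * r) ≤ Valued.v (ϖ ^ (h - k)) := by
    have := mul_le_mul' (le_refl (Valued.v (ϖ ^ k))⁻¹) h1
    rwa [inv_mul_cancel_left₀ hk0, inv_mul_cancel_left₀ hk0] at this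
  have h3 : Valued.v (ϖ ^ (h - k)) ≤ Valued.v (ϖ ^ j) := by
    rw [map_pow, map_pow]; exact pow_le_pow_right_of_le_one' hϖ1 (by omega)
  have h4 : Valued.v (x * r) ≤ Valued.v (ϖ ^ j) := h2.trans h3
  rw [v_le_iff_valuation_le] at h4
  rwa [map_pow] at h4

end Val

/-! ## §2 Levels vs balls: `K_γ ⊆ 𝔅_0`; the deep level `y K_{m+s} y⁻¹ ⊆ K_m` for `y ∈ 𝔅_s` -/

section Levels

variable {F : Type*} [Field F] [Valued F ℤᵐ⁰] [ValuativeRel F] [(Valued.v : Valuation F ℤᵐ⁰).Compatible] {n : ℕ}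

/-- **`K_γ ⊆ 𝔅_0`**: every element of a principal congruence subgroup (integral with integral inverse) has `Ad`-height `≤ 1`.
[cite: HarishChandra1970, Part VII §2 p. 69] [cite: Casselman1995, Prop. 1.4.3] -/
theorem adBall_zero_of_mem_congruenceGL (ϖ : F) {γ : ValueGroupWithZero F} {k : GL (Fin n) F} (hk : k ∈ congruenceGL n γ) :
    ∀ i j a b, Valued.v (ϖ ^ 0 * ((k : Matrix (Fin n) (Fin n) F) i j * ((k⁻¹ : GL (Fin n) F) : Matrix (Fin n) (Fin n) F) a b)) ≤ 1 :=
  adBall_zero_of_forall_v_le_one ϖ (fun i j => (v_le_one_iff_valuation_le_one _).2 (hk.1.1 i j)) (fun i j => (v_le_one_iff_valuation_le_one _).2 (hk.1.2 i j))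

omit [ValuativeRel F] [(Valued.v : Valuation F ℤᵐ⁰).Compatible] in
/-- Conjugating a matrix congruent to `0` modulo `|ϖ|^{m+s}` by an element of `𝔅_s`: if `|ϖ^s y_{ik} (y⁻¹)_{lj}| ≤ 1` for all indices and every entry of `N` has
`Valued.v ≤ |ϖ^{m+s}|`, then every entry of `y N y⁻¹` has `Valued.v ≤ |ϖ^m|`. [cite: HarishChandra1970, Part VII §8 Lemma 56 p. 83] -/
theorem v_conj_apply_le {ϖ : F} (hϖ : Valued.v ϖ = WithZero.exp (-1 : ℤ)) {m s : ℕ} {Y Y' N : Matrix (Fin n) (Fin n) F}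
    (hY : ∀ i k l j, Valued.v (ϖ ^ s * (Y i k * Y' l j)) ≤ 1) (hN : ∀ k l, Valued.v (N k l) ≤ Valued.v (ϖ ^ (m + s))) (i j : Fin n) :
    Valued.v ((Y * N * Y') i j) ≤ Valued.v (ϖ ^ m) := by
  have hs0 : Valued.v (ϖ ^ s) ≠ 0 := v_pow_ne_zero hϖ s
  rw [Matrix.mul_apply]
  refine Valuation.map_sum_le _ fun l _ => ?_
  rw [Matrix.mul_apply, Finset.sum_mul]
  refine Valuation.map_sum_le _ fun k _ => ?_
  -- `|Y_{ik} N_{kl} Y'_{lj}| · |ϖ^s| ≤ |ϖ^{m+s}| = |ϖ^s| |ϖ^m|`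
  have h1 : Valued.v (ϖ ^ s) * Valued.v (Y i k * N k l * Y' l j) ≤ Valued.v (ϖ ^ s) * Valued.v (ϖ ^ m) := by
    calc Valued.v (ϖ ^ s) * Valued.v (Y i k * N k l * Y' l j) = Valued.v (ϖ ^ s * (Y i k * Y' l j)) * Valued.v (N k l) := by
          rw [← map_mul, ← map_mul]; congr 1; ring
      _ ≤ 1 * Valued.v (ϖ ^ (m + s)) := mul_le_mul' (hY i k l j) (hN k l)
      _ = Valued.v (ϖ ^ s) * Valued.v (ϖ ^ m) := by rw [one_mul, ← map_mul, ← pow_add, add_comm]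
  have := mul_le_mul' (le_refl (Valued.v (ϖ ^ s))⁻¹) h1
  rwa [inv_mul_cancel_left₀ hs0, inv_mul_cancel_left₀ hs0] at this

/-- For `g ∈ K_{|ϖ|^{m+s}}` and `y ∈ 𝔅_s`: `y g y⁻¹ − 1 = y (g − 1) y⁻¹` is congruent to `0` modulo `|ϖ|^m` and `y g y⁻¹` is integral (one half of the membership
`y g y⁻¹ ∈ K_{|ϖ|^m}`; the other half is the same statement for `g⁻¹`). [cite: HarishChandra1970, Part VII §8 Lemma 56 p. 83] -/
theorem valBound_conj_of_mem_congruenceGL {ϖ : F} (hϖ : Valued.v ϖ = WithZero.exp (-1 : ℤ)) {m s : ℕ} {y g : GL (Fin n) F}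
    (hy : ∀ i j k l, Valued.v (ϖ ^ s * ((y : Matrix (Fin n) (Fin n) F) i j * ((y⁻¹ : GL (Fin n) F) : Matrix (Fin n) (Fin n) F) k l)) ≤ 1)
    (hg : g ∈ congruenceGL n (valuation F ϖ ^ (m + s))) :
    ValBound (valuation F ϖ ^ m) (((y * g * y⁻¹ : GL (Fin n) F) : Matrix (Fin n) (Fin n) F) - 1) ∧ ValBound 1 ((y * g * y⁻¹ : GL (Fin n) F) : Matrix (Fin n) (Fin n) F) := by
  have hconj : ((y * g * y⁻¹ : GL (Fin n) F) : Matrix (Fin n) (Fin n) F) - 1 =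
      (y : Matrix (Fin n) (Fin n) F) * ((g : Matrix (Fin n) (Fin n) F) - 1) * ((y⁻¹ : GL (Fin n) F) : Matrix (Fin n) (Fin n) F) := by
    rw [Units.val_mul, Units.val_mul, Matrix.mul_sub, Matrix.sub_mul, Matrix.mul_one, Units.mul_inv]
  have hN : ∀ k l, Valued.v (((g : Matrix (Fin n) (Fin n) F) - 1) k l) ≤ Valued.v (ϖ ^ (m + s)) := fun k l => by
    rw [v_le_iff_valuation_le, map_pow]; exact hg.2.1 k l
  have hsub : ∀ i j, Valued.v ((((y * g * y⁻¹ : GL (Fin n) F) : Matrix (Fin n) (Fin n) F) - 1) i j) ≤ Valued.v (ϖ ^ m) := fun i j => by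
    rw [hconj]; exact v_conj_apply_le hϖ (fun i k l j => hy i k l j) hN i j
  refine ⟨fun i j => ?_, fun i j => ?_⟩
  · have h := hsub i j
    rw [v_le_iff_valuation_le, map_pow] at h
    exact h
  · have hϖm : Valued.v (ϖ ^ m) ≤ 1 := by
      rw [CartanUnique.v_uniformizer_pow hϖ m, ← WithZero.exp_zero, WithZero.exp_le_exp]; omega
    have e : ((y * g * y⁻¹ : GL (Fin n) F) : Matrix (Fin n) (Fin n) F) i j =
        ((((y * g * y⁻¹ : GL (Fin n) F) : Matrix (Fin n) (Fin n) F) - 1) i j) + (1 : Matrix (Fin n) (Fin n) F) i j := by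
      rw [Matrix.sub_apply, sub_add_cancel]
    rw [← v_le_one_iff_valuation_le_one, e]
    refine (Valuation.map_add _ _ _).trans (max_le ((hsub i j).trans hϖm) ?_)
    by_cases hij : i = j
    · rw [hij, Matrix.one_apply_eq, map_one]
    · rw [Matrix.one_apply_ne hij, map_zero]; exact zero_le

/-- **THE DEEP LEVEL** (`hdeep`): for `y ∈ 𝔅_s` and `u ∈ K_{|ϖ|^{m+s}}`, **`y u y⁻¹ ∈ K_{|ϖ|^m}`** (and of course `u ∈ K_{|ϖ|^m}`).  With the scale-invariant balls the
loss is `s`, not print's `2s` (`𝔅_s` bounds `|y_{ik}(y⁻¹)_{lj}|` jointly). [cite: HarishChandra1970, Part VII §8 Lemma 56 p. 83] [cite: Casselman1995, Prop. 1.4.3] -/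
theorem conj_mem_congruenceGL_of_adBall {ϖ : F} (hϖ : Valued.v ϖ = WithZero.exp (-1 : ℤ)) {m s : ℕ} {y u : GL (Fin n) F}
    (hy : ∀ i j k l, Valued.v (ϖ ^ s * ((y : Matrix (Fin n) (Fin n) F) i j * ((y⁻¹ : GL (Fin n) F) : Matrix (Fin n) (Fin n) F) k l)) ≤ 1)
    (hu : u ∈ congruenceGL n (valuation F ϖ ^ (m + s))) :
    y * u * y⁻¹ ∈ congruenceGL n (valuation F ϖ ^ m) := by
  obtain ⟨h1, h2⟩ := valBound_conj_of_mem_congruenceGL hϖ hy hu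
  obtain ⟨h3, h4⟩ := valBound_conj_of_mem_congruenceGL hϖ hy (Subgroup.inv_mem _ hu)
  have e : (y * u * y⁻¹)⁻¹ = y * u⁻¹ * y⁻¹ := by group
  refine ⟨⟨h2, ?_⟩, h1, ?_⟩
  · rw [e]; exact h4
  · rw [e]; exact h3

/-- Monotonicity of the levels in the exponent: `K_{|ϖ|^a} ≤ K_{|ϖ|^b}` for `b ≤ a`. [cite: Casselman1995, Prop. 1.4.3] -/
theorem congruenceGL_pow_le_pow {ϖ : F} (hϖ : Valued.v ϖ = WithZero.exp (-1 : ℤ)) {a b : ℕ} (hba : b ≤ a) :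
    congruenceGL n (valuation F ϖ ^ a) ≤ congruenceGL n (valuation F ϖ ^ b) := by
  refine congruenceGL_mono (pow_le_pow_right_of_le_one' ?_ hba)
  rw [← v_le_one_iff_valuation_le_one, hϖ, ← WithZero.exp_zero, WithZero.exp_le_exp]; norm_num

end Levels

/-! ## §3 A general block labelling `c`: the piece of diagonal elements and its five hypotheses -/

section Labels

variable {F : Type*} [Field F] {n : ℕ} {α : Type*} [LinearOrder α] [Fintype α] (c : Fin n → α)

/-- Entries of `a g a⁻¹` for `a = diag(d)`: `d_i g_{ij} d_j⁻¹`. [cite: HarishChandra1970, Part VII §8 p. 82] -/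
theorem coe_conj_apply_of_coe_eq_diagonal {a : GL (Fin n) F} {d : Fin n → F} (ha : (a : Matrix (Fin n) (Fin n) F) = Matrix.diagonal d) (g : GL (Fin n) F)
    (i j : Fin n) : ((a * g * a⁻¹ : GL (Fin n) F) : Matrix (Fin n) (Fin n) F) i j = d i * (g : Matrix (Fin n) (Fin n) F) i j * (d j)⁻¹ := by
  rw [Units.val_mul, Units.val_mul, ha, coe_inv_eq_diagonal_inv ha, Matrix.mul_diagonal, Matrix.diagonal_mul]

/-- Entries of `a⁻¹ g a` for `a = diag(d)`: `d_i⁻¹ g_{ij} d_j` («`(a⁻¹ n a)_{ij} = a_i⁻¹ a_j n_{ij}`»). [cite: HarishChandra1970, Part VII §8 Lemma 55 p. 83] -/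
theorem coe_inv_conj_apply_of_coe_eq_diagonal {a : GL (Fin n) F} {d : Fin n → F} (ha : (a : Matrix (Fin n) (Fin n) F) = Matrix.diagonal d) (g : GL (Fin n) F)
    (i j : Fin n) : ((a⁻¹ * g * a : GL (Fin n) F) : Matrix (Fin n) (Fin n) F) i j = (d i)⁻¹ * (g : Matrix (Fin n) (Fin n) F) i j * d j := by
  have h := coe_conj_apply_of_coe_eq_diagonal (a := a⁻¹) (coe_inv_eq_diagonal_inv ha) g i j
  rwa [inv_inv, inv_inv] at h

/-- The off-identity part of `a g a⁻¹`: `(a g a⁻¹ − 1)_{ij} = (g − 1)_{ij} · d_i d_j⁻¹` (the diagonal correction vanishes). [cite: HarishChandra1970, Part VII §8 p. 82] -/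
theorem coe_conj_sub_one_apply_of_coe_eq_diagonal {a : GL (Fin n) F} {d : Fin n → F} (ha : (a : Matrix (Fin n) (Fin n) F) = Matrix.diagonal d) (g : GL (Fin n) F)
    (i j : Fin n) : (((a * g * a⁻¹ : GL (Fin n) F) : Matrix (Fin n) (Fin n) F) - 1) i j = (((g : Matrix (Fin n) (Fin n) F) - 1) i j) * (d i * (d j)⁻¹) := by
  rw [Matrix.sub_apply, coe_conj_apply_of_coe_eq_diagonal ha, Matrix.sub_apply]
  by_cases hij : i = j
  · subst hij
    rw [Matrix.one_apply_eq, mul_inv_cancel₀ (ne_zero_of_coe_eq_diagonal ha i)]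
    have hdi := ne_zero_of_coe_eq_diagonal ha i
    field_simp
  · rw [Matrix.one_apply_ne hij, sub_zero, sub_zero]; ring

/-- A diagonal element lies in every standard Levi subgroup. [cite: BernsteinZelevinsky1977, §2.1] -/
theorem mem_standardLeviGL_of_coe_eq_diagonal {a : GL (Fin n) F} {d : Fin n → F} (ha : (a : Matrix (Fin n) (Fin n) F) = Matrix.diagonal d) :
    a ∈ standardLeviGL F c := by
  refine (mem_standardLeviGL_iff c a).2 fun i j hij => ?_
  rw [ha, Matrix.diagonal_apply_ne]
  rintro rfl; exact hij rfl

/-- **`hnormU`**: a diagonal element normalises every standard unipotent radical: `a U_c a⁻¹ ⊆ U_c` (`a ∈ M_c` and ★ `conj_mem_unipotentRadicalGL_of_mem_standardLeviGL`).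
[cite: BernsteinZelevinsky1977, §2.1] [cite: HarishChandra1970, Part VII §8 p. 82] -/
theorem conj_mem_unipotentRadicalGL_of_coe_eq_diagonal {a : GL (Fin n) F} {d : Fin n → F} (ha : (a : Matrix (Fin n) (Fin n) F) = Matrix.diagonal d)
    {u : GL (Fin n) F} (hu : u ∈ unipotentRadicalGL F c) : a * u * a⁻¹ ∈ unipotentRadicalGL F c :=
  conj_mem_unipotentRadicalGL_of_mem_standardLeviGL c (mem_standardLeviGL_of_coe_eq_diagonal c ha) hu

variable [Valued F ℤᵐ⁰] [ValuativeRel F] [(Valued.v : Valuation F ℤᵐ⁰).Compatible]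

omit [LinearOrder α] [Fintype α] in
/-- **GENERIC LEVEL-PRESERVATION UNDER `Ad(a)`**: `a = diag(d)`, `g ∈ K_γ`; if `|d_i d_j⁻¹| ≤ 1` at every position `(i, j)` where `g` or `g⁻¹` differs from the identity
matrix, then `a g a⁻¹ ∈ K_γ`. [cite: HarishChandra1970, Part VII §8 Lemma 55 p. 82] [cite: Casselman1995, Prop. 1.4.3] -/
theorem conj_mem_congruenceGL_of_pattern {a : GL (Fin n) F} {d : Fin n → F} (ha : (a : Matrix (Fin n) (Fin n) F) = Matrix.diagonal d)
    {γ : ValueGroupWithZero F} {g : GL (Fin n) F} (hg : g ∈ congruenceGL n γ)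
    (hpat : ∀ i j, (g : Matrix (Fin n) (Fin n) F) i j ≠ (1 : Matrix (Fin n) (Fin n) F) i j → Valued.v (d i * (d j)⁻¹) ≤ 1)
    (hpat' : ∀ i j, ((g⁻¹ : GL (Fin n) F) : Matrix (Fin n) (Fin n) F) i j ≠ (1 : Matrix (Fin n) (Fin n) F) i j → Valued.v (d i * (d j)⁻¹) ≤ 1) :
    a * g * a⁻¹ ∈ congruenceGL n γ := by
  -- `|r| ≤ 1 ⇒ valuation(x r) ≤ valuation(x) ≤ γ'` (★ U3Torus `valuation_mul_le_of_v_le_one`, inlined)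
  have hmul : ∀ {x r : F} {γ' : ValueGroupWithZero F}, valuation F x ≤ γ' → Valued.v r ≤ 1 → valuation F (x * r) ≤ γ' := by
    intro x r γ' hx hr
    rw [v_le_one_iff_valuation_le_one] at hr
    rw [map_mul]
    calc valuation F x * valuation F r ≤ γ' * 1 := mul_le_mul' hx hr
      _ = γ' := mul_one γ'
  -- one half, for any `g'` with the pattern property: `a g' a⁻¹ − 1 ≡ 0 (γ)` and `a g' a⁻¹` integral
  have key : ∀ g' : GL (Fin n) F, g' ∈ congruenceGL n γ →
      (∀ i j, (g' : Matrix (Fin n) (Fin n) F) i j ≠ (1 : Matrix (Fin n) (Fin n) F) i j → Valued.v (d i * (d j)⁻¹) ≤ 1) →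
      ValBound γ (((a * g' * a⁻¹ : GL (Fin n) F) : Matrix (Fin n) (Fin n) F) - 1) ∧ ValBound 1 ((a * g' * a⁻¹ : GL (Fin n) F) : Matrix (Fin n) (Fin n) F) := by
    intro g' hg' hp
    have hsub : ∀ i j, valuation F ((((a * g' * a⁻¹ : GL (Fin n) F) : Matrix (Fin n) (Fin n) F) - 1) i j) ≤ γ := by
      intro i j
      rw [coe_conj_sub_one_apply_of_coe_eq_diagonal ha]
      by_cases h0 : (g' : Matrix (Fin n) (Fin n) F) i j = (1 : Matrix (Fin n) (Fin n) F) i j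
      · rw [Matrix.sub_apply, h0, sub_self, zero_mul, map_zero]; exact zero_le
      · exact hmul (hg'.2.1 i j) (hp i j h0)
    refine ⟨hsub, fun i j => ?_⟩
    rw [coe_conj_apply_of_coe_eq_diagonal ha]
    by_cases hij : i = j
    · subst hij
      rw [mul_comm (d i), mul_assoc, mul_inv_cancel₀ (ne_zero_of_coe_eq_diagonal ha i), mul_one]
      exact hg'.1.1 i i
    · by_cases h0 : (g' : Matrix (Fin n) (Fin n) F) i j = (1 : Matrix (Fin n) (Fin n) F) i j
      · rw [h0, Matrix.one_apply_ne hij, mul_zero, zero_mul, map_zero]; exact zero_le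
      · have e : d i * (g' : Matrix (Fin n) (Fin n) F) i j * (d j)⁻¹ = (g' : Matrix (Fin n) (Fin n) F) i j * (d i * (d j)⁻¹) := by ring
        rw [e]
        exact hmul (hg'.1.1 i j) (hp i j h0)
  obtain ⟨h1, h2⟩ := key g hg hpat
  obtain ⟨h3, h4⟩ := key g⁻¹ (Subgroup.inv_mem _ hg) hpat'
  have e : (a * g * a⁻¹)⁻¹ = a * g⁻¹ * a⁻¹ := by group
  refine ⟨⟨h2, ?_⟩, h1, ?_⟩
  · rw [e]; exact h4
  · rw [e]; exact h3

omit [Fintype α] in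
/-- **`hV`: THE PIECE CONJUGATES `K_γ ∩ V_c` INTO `K_γ`** (`V_c = U_{toDual ∘ c}` the opposite radical): if `|d_i⁻¹ d_j| ≤ 1` whenever `c i < c j` (`a⁻¹` does not
expand `U_c`, so `a` does not expand `V_c`), then `a v a⁻¹ ∈ K_γ` for `v ∈ K_γ ∩ V_c`. [cite: HarishChandra1970, Part VII §8 Lemma 55 p. 82 (`(N̄ ∩ K)^a ⊂ K`)]
[cite: Casselman1995, Prop. 1.4.3] -/
theorem conj_mem_congruenceGL_of_mem_oppositeRadical {a : GL (Fin n) F} {d : Fin n → F} (ha : (a : Matrix (Fin n) (Fin n) F) = Matrix.diagonal d)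
    (hd : ∀ i j, c i < c j → Valued.v ((d i)⁻¹ * d j) ≤ 1) {γ : ValueGroupWithZero F} {v : GL (Fin n) F} (hvK : v ∈ congruenceGL n γ)
    (hv : v ∈ unipotentRadicalGL F (⇑OrderDual.toDual ∘ c)) : a * v * a⁻¹ ∈ congruenceGL n γ := by
  have hpat : ∀ g : GL (Fin n) F, g ∈ unipotentRadicalGL F (⇑OrderDual.toDual ∘ c) →
      ∀ i j, (g : Matrix (Fin n) (Fin n) F) i j ≠ (1 : Matrix (Fin n) (Fin n) F) i j → Valued.v (d i * (d j)⁻¹) ≤ 1 := by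
    intro g hg i j hij
    have hg' := (mem_unipotentRadicalGL_iff_apply g).1 hg i j
    by_cases hle : c i ≤ c j
    · exact absurd (hg' hle) hij
    · have h := hd j i (not_le.1 hle)
      rwa [mul_comm] at h
  exact conj_mem_congruenceGL_of_pattern ha hvK (hpat v hv) (hpat v⁻¹ (Subgroup.inv_mem _ hv))

/-- **`hT`: THE LEVI DEFECT** — for `t ∈ K_γ ∩ M_c` and `a = diag(d)` with `|ϖ^E d_i d_j⁻¹| ≤ 1` whenever `c i = c j`, the conjugate `a t a⁻¹` lies in the height ball
`𝔅_{E+E}` (its entries `d_i t_{ij} d_j⁻¹` vanish off the blocks and are `ϖ^{-E}`-bounded on them; likewise for the inverse `a t⁻¹ a⁻¹`; ★ B4-0∕V0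
`adBall_of_forall_v_pow_mul_apply_le_one`).  Rank one (`a` central in `M`): `E = 0`. [cite: HarishChandra1970, Part VII §8 p. 82 (`γ₀ = γ v^a t`)] -/
theorem adBall_conj_of_mem_standardLeviGL (ϖ : F) {a : GL (Fin n) F} {d : Fin n → F} (ha : (a : Matrix (Fin n) (Fin n) F) = Matrix.diagonal d) {E : ℕ}
    (hd : ∀ i j, c i = c j → Valued.v (ϖ ^ E * (d i * (d j)⁻¹)) ≤ 1) {γ : ValueGroupWithZero F} {t : GL (Fin n) F} (htK : t ∈ congruenceGL n γ)
    (ht : t ∈ standardLeviGL F c) :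
    ∀ i j k l, Valued.v (ϖ ^ (E + E) * (((a * t * a⁻¹ : GL (Fin n) F) : Matrix (Fin n) (Fin n) F) i j *
      (((a * t * a⁻¹)⁻¹ : GL (Fin n) F) : Matrix (Fin n) (Fin n) F) k l)) ≤ 1 := by
  have key : ∀ t' : GL (Fin n) F, t' ∈ congruenceGL n γ → t' ∈ standardLeviGL F c →
      ∀ i j, Valued.v (ϖ ^ E * ((a * t' * a⁻¹ : GL (Fin n) F) : Matrix (Fin n) (Fin n) F) i j) ≤ 1 := by
    intro t' ht'K ht'M i j
    rw [coe_conj_apply_of_coe_eq_diagonal ha]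
    by_cases hij : c i = c j
    · have e : ϖ ^ E * (d i * (t' : Matrix (Fin n) (Fin n) F) i j * (d j)⁻¹) = ϖ ^ E * (d i * (d j)⁻¹) * (t' : Matrix (Fin n) (Fin n) F) i j := by ring
      rw [e, map_mul]
      have h1 : Valued.v ((t' : Matrix (Fin n) (Fin n) F) i j) ≤ 1 := (v_le_one_iff_valuation_le_one _).2 (ht'K.1.1 i j)
      calc Valued.v (ϖ ^ E * (d i * (d j)⁻¹)) * Valued.v ((t' : Matrix (Fin n) (Fin n) F) i j) ≤ 1 * 1 := mul_le_mul' (hd i j hij) h1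
        _ = 1 := one_mul 1
    · rw [(mem_standardLeviGL_iff c t').1 ht'M i j hij, mul_zero, zero_mul, mul_zero, map_zero]; exact zero_le
  have e : (a * t * a⁻¹)⁻¹ = a * t⁻¹ * a⁻¹ := by group
  have h1 := key t htK ht
  have h2 : ∀ k l, Valued.v (ϖ ^ E * (((a * t * a⁻¹)⁻¹ : GL (Fin n) F) : Matrix (Fin n) (Fin n) F) k l) ≤ 1 := by
    rw [e]; exact key t⁻¹ (Subgroup.inv_mem _ htK) (Subgroup.inv_mem _ ht)
  exact adBall_of_forall_v_pow_mul_apply_le_one ϖ h1 h2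

omit [ValuativeRel F] [(Valued.v : Valuation F ℤᵐ⁰).Compatible] [Fintype α] in
/-- The entries of an element of `U_c ∩ 𝔅_k`: `|ϖ^k u_{ij}| ≤ 1` (the quadruple `(i, j, j, j)` of `𝔅_k(u)`, `(u⁻¹)_{jj} = 1`). [cite: HarishChandra1970, Part VII §8 Lemma 54 p. 82] -/
theorem v_pow_mul_apply_le_one_of_adBall_of_mem {ϖ : F} {k : ℕ} {u : GL (Fin n) F} (hu : u ∈ unipotentRadicalGL F c)
    (h : ∀ i j a b, Valued.v (ϖ ^ k * ((u : Matrix (Fin n) (Fin n) F) i j * ((u⁻¹ : GL (Fin n) F) : Matrix (Fin n) (Fin n) F) a b)) ≤ 1) (i j : Fin n) :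
    Valued.v (ϖ ^ k * (u : Matrix (Fin n) (Fin n) F) i j) ≤ 1 := by
  have hjj : ((u⁻¹ : GL (Fin n) F) : Matrix (Fin n) (Fin n) F) j j = 1 := by
    rw [(mem_unipotentRadicalGL_iff_apply u⁻¹).1 (Subgroup.inv_mem _ hu) j j le_rfl, Matrix.one_apply_eq]
  have h1 := h i j j j
  rwa [hjj, mul_one] at h1

omit [Fintype α] in
/-- **`hcontr`: THE CONTRACTION** — `a = diag(d)` with `|d_i⁻¹ d_j| ≤ |ϖ^h|` whenever `c i < c j`, `u ∈ U_c ∩ 𝔅_k`, `j + k ≤ h` ⇒ **`a⁻¹ u a ∈ K_{|ϖ|^j}`**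
(`(a⁻¹ u a − 1)_{ij} = u_{ij} d_i⁻¹ d_j` for `c i < c j`, `= 0` otherwise; `|u_{ij}| ≤ q^k`; the same for `u⁻¹ ∈ U_c ∩ 𝔅_k`).
[cite: HarishChandra1970, Part VII §8 Lemma 55 p. 83] [cite: Casselman1995, Prop. 1.4.3] -/
theorem inv_conj_mem_congruenceGL_of_adBall {ϖ : F} (hϖ : Valued.v ϖ = WithZero.exp (-1 : ℤ)) {a : GL (Fin n) F} {d : Fin n → F}
    (ha : (a : Matrix (Fin n) (Fin n) F) = Matrix.diagonal d) {h k j : ℕ} (hd : ∀ i j, c i < c j → Valued.v ((d i)⁻¹ * d j) ≤ Valued.v (ϖ ^ h))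
    {u : GL (Fin n) F} (hu : u ∈ unipotentRadicalGL F c)
    (huk : ∀ i j a b, Valued.v (ϖ ^ k * ((u : Matrix (Fin n) (Fin n) F) i j * ((u⁻¹ : GL (Fin n) F) : Matrix (Fin n) (Fin n) F) a b)) ≤ 1) (hjk : j + k ≤ h) :
    a⁻¹ * u * a ∈ congruenceGL n (valuation F ϖ ^ j) := by
  have hϖ1 : valuation F ϖ ^ j ≤ 1 := by
    refine pow_le_one₀ zero_le ?_
    rw [← v_le_one_iff_valuation_le_one, hϖ, ← WithZero.exp_zero, WithZero.exp_le_exp]; norm_num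
  have ha' : ((a⁻¹ : GL (Fin n) F) : Matrix (Fin n) (Fin n) F) = Matrix.diagonal fun i => (d i)⁻¹ := coe_inv_eq_diagonal_inv ha
  -- one half, for `g ∈ U_c ∩ 𝔅_k`
  have key : ∀ g : GL (Fin n) F, g ∈ unipotentRadicalGL F c →
      (∀ i j a b, Valued.v (ϖ ^ k * ((g : Matrix (Fin n) (Fin n) F) i j * ((g⁻¹ : GL (Fin n) F) : Matrix (Fin n) (Fin n) F) a b)) ≤ 1) →
      ValBound (valuation F ϖ ^ j) (((a⁻¹ * g * a⁻¹⁻¹ : GL (Fin n) F) : Matrix (Fin n) (Fin n) F) - 1) ∧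
        ValBound 1 ((a⁻¹ * g * a⁻¹⁻¹ : GL (Fin n) F) : Matrix (Fin n) (Fin n) F) := by
    intro g hg hgk
    have hg1 := (mem_unipotentRadicalGL_iff_apply g).1 hg
    have hsub : ∀ i' j', valuation F ((((a⁻¹ * g * a⁻¹⁻¹ : GL (Fin n) F) : Matrix (Fin n) (Fin n) F) - 1) i' j') ≤ valuation F ϖ ^ j := by
      intro i' j'
      rw [coe_conj_sub_one_apply_of_coe_eq_diagonal ha', inv_inv, Matrix.sub_apply]
      by_cases hij : c i' < c j'
      · have hne : i' ≠ j' := by rintro rfl; exact lt_irrefl _ hij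
        rw [Matrix.one_apply_ne hne, sub_zero]
        exact valuation_mul_le_pow_of_le' hϖ (v_pow_mul_apply_le_one_of_adBall_of_mem c hg hgk i' j') (hd i' j' hij) hjk
      · rw [hg1 i' j' (not_lt.1 hij), sub_self, zero_mul, map_zero]; exact zero_le
    refine ⟨hsub, ValBound.of_sub_one hsub hϖ1⟩
  obtain ⟨h1, h2⟩ := key u hu huk
  obtain ⟨h3, h4⟩ := key u⁻¹ (Subgroup.inv_mem _ hu) (by simpa only [inv_inv] using adBall_inv huk)
  rw [inv_inv] at h1 h2 h3 h4
  have e : (a⁻¹ * u * a)⁻¹ = a⁻¹ * u⁻¹ * a := by group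
  refine ⟨⟨h2, ?_⟩, h1, ?_⟩
  · rw [e]; exact h4
  · rw [e]; exact h3

omit [ValuativeRel F] [(Valued.v : Valuation F ℤᵐ⁰).Compatible] [Fintype α] in
/-- **`h54`: LEMMA 54** — for `u ∈ U_c` and a diagonal `a′ = diag(d′)`: `u a′ ∈ 𝔅_k ⇒ u ∈ 𝔅_{2k}` (the unipotent entries of `u` and `u⁻¹` are read off `𝔅_k(u a′)`, ★ V0).
[cite: HarishChandra1970, Part VII §8 Lemma 54 p. 82] -/
theorem adBall_two_mul_of_mem_unipotentRadicalGL (ϖ : F) {k : ℕ} {u a' : GL (Fin n) F} {d' : Fin n → F}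
    (ha' : (a' : Matrix (Fin n) (Fin n) F) = Matrix.diagonal d') (hu : u ∈ unipotentRadicalGL F c)
    (h : ∀ i j a b, Valued.v (ϖ ^ k * (((u * a' : GL (Fin n) F) : Matrix (Fin n) (Fin n) F) i j * (((u * a')⁻¹ : GL (Fin n) F) : Matrix (Fin n) (Fin n) F) a b)) ≤ 1) :
    ∀ i j a b, Valued.v (ϖ ^ (2 * k) * ((u : Matrix (Fin n) (Fin n) F) i j * ((u⁻¹ : GL (Fin n) F) : Matrix (Fin n) (Fin n) F) a b)) ≤ 1 := by
  have hdiag : ∀ i, (u : Matrix (Fin n) (Fin n) F) i i = 1 := fun i => by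
    rw [(mem_unipotentRadicalGL_iff_apply u).1 hu i i le_rfl, Matrix.one_apply_eq]
  have hdiag' : ∀ i, ((u⁻¹ : GL (Fin n) F) : Matrix (Fin n) (Fin n) F) i i = 1 := fun i => by
    rw [(mem_unipotentRadicalGL_iff_apply u⁻¹).1 (Subgroup.inv_mem _ hu) i i le_rfl, Matrix.one_apply_eq]
  rw [two_mul]
  exact adBall_of_forall_v_pow_mul_apply_le_one ϖ (v_pow_mul_apply_le_one_of_adBall_mul_diagonal ha' hdiag' h)
    (v_pow_mul_inv_apply_le_one_of_adBall_mul_diagonal ha' hdiag h)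

end Labels

end Summit.HodgeConjecture.HodgeConjecture.Cruxes.H413.K2E3GLnCuspFormCancellationInputs

end
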